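import Summits.BirchSwinnertonDyer.BirchSwinnertonDyer.Theses.KatoDescentPotSupersingular
import Summits.BirchSwinnertonDyer.BirchSwinnertonDyer.Theorems.KatoDescentPotSupersingularWildFineSelmerCongruenceFact
import Literature.NumberTheory.EllipticCurves.FineSelmerClassGroupCriterion
import HarnessLib

/-!
# BC3 BIRTH SKELETON v2 — crux `WildCoatesSujathaResidue` (item stmt-BirchSwinnertonDyer-19942; route K9 =
# `Theses/KatoDescentPotSupersingular.lean` rev 21, rank 7; planner bsd-potss-plan g22, 2026-08-27;
# supersedes v1 = `Lines/v1_residueClasses_plan_g21.lean`, whose S1 is kept verbatim)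

The crux is Coates–Sujatha's Conjecture A (fine-Selmer-dual reading, `p = 3`) on the O6 RESIDUE classes:
non-CM wild-3 rank-0 curves of class O6 with `W[3]` irreducible and the 3-adic tower not onto, whose
isogeny class has a lattice-optimal member `W₀` that is EITHER Manin-dirty (`3 ∣ c(D₀)`; census ∅) OR has
`3 ∣ ∏ c_ℓ(W₀)` carried by no single admissible prime `q` — the classes the sharp Heegner-index roads
(`JetchevIrreducibleReadingByName`, `WildJetchevBoundAtP`) cannot reach.

WHAT CHANGED SINCE v1 (why a re-cut). (i) The definition request of plan g21 LANDED: Coates–Sujatha 2005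
Thm. 3.4 is now the named fact `CoatesSujatha2005.thm34_fineSelmerDual_moduleFinite_of_classicalMuVanishes_divisionField`
(p507734, over `IwasawaTheory.ClassicalMuVanishes`, growth form of Iwasawa's classical `μ = 0`), so road (b)
of v1 — «classical `μ(ℚ(W[3])_cyc) = 0` ⇒ (A)» — is typable BY NAME. (ii) The anchor apparatus of k9-c4 /
conjA-anchor (`O6.ModPCongruent`, `WildFineSelmerCongruenceFact.conjA_of_modPCongruent` under the named
Lim–Sujatha fact, `WildFineSelmerOrdinaryAnchor.conjA_rat_of_finite_selmerInfty_pTorsion` PROVED) makes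
road (a) — «(A) at a `W[3]`-congruent `W′` ⇒ (A) at `W`» — a one-line transfer for ANY anchor, CM or not.
(iii) Planner finding (g22): the Deo–Ray–Sujatha class-group road (`DeoRaySujatha2023.thm39_…`, k9-c4 g7)
is DEAD ON THE WHOLE MULTI-CARRIER CLASS: every such row has a Tamagawa carrier `ℓ ≠ 3` with `3 ∣ c_ℓ`
(if `ℓ = 3` were the only carrier, `q = 3` would be an admissible single carrier), and `3 ∣ c_ℓ`, `ℓ ≠ 3`
forces `W(ℚ_ℓ)[3] ≠ 0` (`E¹(ℚ_ℓ) ≅ ℤ_ℓ` is uniquely 3-divisible, so `E(ℚ_ℓ)[3^∞] ≅ (E/E¹)(ℚ_ℓ)[3^∞]`,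
and `#(E/E¹)(ℚ_ℓ) = #Ẽ_ns(𝔽_ℓ)·c_ℓ`), violating hypothesis (c3) `E(ℚ_v)[p] = 0` of Thm. 3.9 at `v = ℓ`.
Coates–Sujatha's Thm. 3.4 has NO local hypothesis — it is the only class-group road left on the residue.

THE CUT v2 — by residue class, then by INPUT ROAD (three registered stubs, ≤ 7):
* `stub_residue_maninDirty` (S1, size L–XL, verbatim from v1): (A) on the Manin-dirty residue class.
  Census ∅ on the K9 rows. Roads: EMPTINESS first (`3 ∤ c(D₀)` for the optimal member: Mazur 1978
  `p ∣ c ⇒ p² ∣ 4N`, so additive 3 is not excluded a priori; Česnavičius–Neururer–Saha arXiv:1911.09446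
  `ord_p c ≤ ord_p deg φ`; Cremona: `c = 1` for every optimal curve of conductor `≤ 500000`), else the
  roads of S2. WHY IT MIGHT FAIL: (A) is open and a Manin-dirty optimal curve with additive potentially
  supersingular 3 may exist beyond the tables; one such curve with `μ(Y(W/ℚ_cyc)) ≠ 0` refutes it.
  SOURCES: CoatesSujatha2005 Thm 3.4; Mazur1978; arXiv:1911.09446; arXiv:2202.09937.
* `stub_residue_multiCarrier_anchorOrClassicalMu` (S2, size XL, the load-bearing stub): for every
  multi-carrier residue row `W`, EITHER (a) a MIXED ANCHOR CERTIFICATE in exactly the shape consumed by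
  `WildFineSelmerCongruenceFact.wildFineSelmerCoatesSujatha_of_mixedCertificates` — an elliptic `W′/ℚ`
  with `W′[3] ≃ W[3]` (`O6.ModPCongruent W′ W 3`) and EITHER (A) at `(W′,3)` OR finite `3`-torsion of
  `Sel_{3^∞}(W′/ℚ_cyc)` for every cyclotomic datum (the currency of the ordinary / supersingular / Kato-fine
  / Cha / CM / small-conductor unit-anchor files of k9-c4 g5–g7 and conjA-anchor g1–g4, all of which
  produce such certificates) — OR (b) Iwasawa's classical `μ = 0` for the cyclotomic `ℤ₃`-extension of the
  3-division field `L = ℚ(W[3])` (`ClassicalMuVanishes`, growth form). ROADS PER IMAGE TYPE of the residue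
  rows (`G = Gal(L/ℚ)` ∈ {`3Ns` = D₄ (order 8), `3Nn` = SD₁₆ (order 16), `GL₂(𝔽₃)` (order 48, the
  9-deficient / Elkies rows)}): (b1) IWASAWA'S CRITERION (Iwasawa 1956; Greenberg, *Iwasawa theory — past
  and present*, Prop. 2.1: «class number of `F` not divisible by `p` and only one prime of `F` over `p` ⇒
  `λ = μ = ν = 0` for ANY `ℤ_p`-extension»; Lang GTM 121 Ch. 5 §4 Thm. 4.1 (iii) + Nakayama): on a
  Cartan-normaliser row with `[ℚ₃(W[3]) : ℚ₃] = #G` (one prime of `L` above 3 — impossible on `GL₂(𝔽₃)`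
  rows, where `#D₃ ≤ 16 < 48`) and `3 ∤ h(L)` (k9-c4 g7's class-number census, kit j265757), `e_n = 0` for
  all `n`, hence `ClassicalMuVanishes` by `classicalMuVanishes_of_eventually_const` — a per-row FINITE check
  with NO local torsion condition (the named fact for the criterion is requested from the typer lane by plan
  g22); (b2) Fukuda-type stabilisation (`#A(L₁) = #A(L)` under total ramification) for the other normaliser
  rows; (a1) on `GL₂(𝔽₃)` rows the anchors: the mod-3 congruence family `X_W(3) ≅ ℙ¹_ℚ` (Rubin–Silverberg)
  supplies infinitely many non-CM `W′_t`, generically with SURJECTIVE 3-adic tower, to be certified by the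
  unit-anchor files (ordinary: `μ`-zero unit data; supersingular; Kato-fine `#Ш[3^∞] = 1 ∧ 3 ∤ ∏ c_ℓ(W′)`);
  (b3) the bare conjecture (Iwasawa 1973) elsewhere. WHY IT MIGHT FAIL: (A) is open; Iwasawa's `μ = 0` is
  open for the non-abelian fields `ℚ(W[3])` (Ferrero–Washington covers abelian fields only); a multi-carrier
  row whose mod-3 family has no certifiable anchor AND whose 3-division field has `μ > 0` refutes the stub
  (not (A)). SOURCES: CoatesSujatha2005 Thm 3.4; LimSujatha2018 Prop 3.2; GreenbergVatsal2000 Prop 2.8;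
  Iwasawa1973; Greenberg2001IwasawaPastPresent Prop 2.1; Lang1990 Ch 5 §4 Thm 4.1; RubinSilverberg1995
  (families with constant mod-3 representation); arXiv:2202.09937 (why DRS does not apply).
* `stub_publishedInputs_LS18_CS05` (S3, cite-level, held BY NAME): the two printed transfers as named
  Literature facts — Lim–Sujatha 2018 Prop. 3.2 (`prop32_…`, p445851) and Coates–Sujatha 2005 Thm. 3.4
  (`thm34_…`, p507734). Never a prover target; on first use toward closing the item the planner item-states
  the two constants on the route (director-bsd R103), exactly as `PublishedInputsFineSelmerCM`.
`WildCoatesSujathaResidue_of` is the case split on the crux's disjunction followed, on the multi-carrier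
class, by the case split of S2: anchor-with-(A) ↦ `conjA_of_modPCongruent`; anchor-with-finite-Selmer-torsion
↦ `conjA_rat_of_finite_selmerInfty_pTorsion` then the same transfer; classical `μ = 0` ↦ Thm. 3.4. Three
`sorry`s, all inside `stub_*`. `residue_of_aside` (PROVED) records that the aside 19386
`WildFineSelmerCoatesSujatha` ((A) on ALL irreducible tower-non-surjective wild rows) implies the crux, so
every class-form certificate theorem `wildFineSelmerCoatesSujatha_of_*Certificates` closes it too.
Neither new stub is the crux (S2 covers one residue class and concludes a certificate / a class-group
statement, not (A); S3 is two transfers) and none implies `O6Sharp`.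
-/

noncomputable section

open scoped Classical

open WeierstrassCurve Literature.NumberTheory.EllipticCurves
open Literature.NumberTheory.EllipticCurves.ModularForms
open Literature.NumberTheory.EllipticCurves.Rank1Residual
open Literature.NumberTheory.IwasawaTheory
open Summit.BirchSwinnertonDyer.Rank1Residual.O6
open Summit.BirchSwinnertonDyer.BirchSwinnertonDyer.Theorems

namespace Summit.BirchSwinnertonDyer.BirchSwinnertonDyer.Cruxes.WildCoatesSujathaResidue.Birth

/-- Statement of `stub_residue_maninDirty` (S1, verbatim from v1): Conjecture A at `3` (fine-Selmer-dual
reading) on the O6 residue rows whose lattice-optimal isogenous member is Manin-dirty, `3 ∣ c(D₀)`.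
[CoatesSujatha2005 Thm 3.4; Mazur1978; arXiv:1911.09446; arXiv:2202.09937] -/
abbrev Sig.stub_residue_maninDirty : Prop :=
  ∀ (W : WeierstrassCurve ℚ) [W.IsElliptic] [W.IsGloballyMinimal] [Fact (3 : ℕ).Prime],
    W.analyticRank = 0 → Summit.BirchSwinnertonDyer.Rank1Residual.Additive.ClassO6 W 3 →
    W.HasIrreducibleModPGaloisRep 3 → ¬ (∀ n : ℕ, W.HasSurjectiveModNGaloisRep (3 ^ n : ℕ)) →
    ¬ W.HasCM →
    (∃ (W₀ : WeierstrassCurve ℚ) (_ : W₀.IsElliptic) (_ : W₀.IsGloballyMinimal)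
        (_ : NeZero (W₀.conductorNorm ℤ))
        (D₀ : ModularParametrizationData W₀ (W₀.conductorNorm ℤ)),
      WeierstrassCurve.IsIsogenous W W₀ ∧
      (∀ z ∈ D₀.L.lattice, ∃ w ∈ periodLattice D₀.f, z = (D₀.c : ℂ) * w) ∧ (3 : ℤ) ∣ D₀.c) →
    ∀ (κ : ZpExtension ℚ 3), κ.IsCyclotomic →
      ∃ (γ : Field.absoluteGaloisGroup ℚ) (Df : W.FineSelmerDualData κ γ),
        Module.Finite ℤ_[3] (RestrictScalars ℤ_[3] (IwasawaAlgebra 3) Df.X)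

/-- Statement of `stub_residue_multiCarrier_anchorOrClassicalMu` (S2): on every multi-carrier O6 residue
row, EITHER a mixed anchor certificate (a `W[3]`-congruent elliptic `W′` with (A) at `(W′,3)` or with finite
`3`-torsion of `Sel_{3^∞}(W′/ℚ_cyc)` for every cyclotomic datum) OR Iwasawa's classical `μ = 0` for the
cyclotomic `ℤ₃`-extension(s) of `ℚ(W[3])`. [CoatesSujatha2005 Thm 3.4; LimSujatha2018 Prop 3.2;
GreenbergVatsal2000 Prop 2.8; Iwasawa1973; Greenberg2001IwasawaPastPresent Prop 2.1; Lang1990 Ch 5 §4] -/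
abbrev Sig.stub_residue_multiCarrier_anchorOrClassicalMu : Prop :=
  ∀ (W : WeierstrassCurve ℚ) [W.IsElliptic] [W.IsGloballyMinimal] [Fact (3 : ℕ).Prime],
    W.analyticRank = 0 → Summit.BirchSwinnertonDyer.Rank1Residual.Additive.ClassO6 W 3 →
    W.HasIrreducibleModPGaloisRep 3 → ¬ (∀ n : ℕ, W.HasSurjectiveModNGaloisRep (3 ^ n : ℕ)) →
    ¬ W.HasCM →
    (∃ (W₀ : WeierstrassCurve ℚ) (_ : W₀.IsElliptic) (_ : W₀.IsGloballyMinimal)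
        (_ : NeZero (W₀.conductorNorm ℤ))
        (D₀ : ModularParametrizationData W₀ (W₀.conductorNorm ℤ)),
      WeierstrassCurve.IsIsogenous W W₀ ∧
      (∀ z ∈ D₀.L.lattice, ∃ w ∈ periodLattice D₀.f, z = (D₀.c : ℂ) * w) ∧
      (3 ∣ W₀.tamagawaProduct ∧ ¬ ∃ (q : ℕ) (_ : Fact q.Prime),
        q ∣ W₀.conductorNorm ℤ ∧
        (q ≠ 3 → ¬ q ^ 2 ∣ W₀.conductorNorm ℤ ∧
          ¬ 3 ∣ (W₀.baseChange ℚ_[3]).localTamagawaNumber ℤ_[3]) ∧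
        padicValNat 3 W₀.tamagawaProduct ≤
          padicValNat 3 ((W₀.baseChange ℚ_[q]).localTamagawaNumber ℤ_[q]))) →
    (∃ (W' : WeierstrassCurve ℚ) (_ : W'.IsElliptic), ModPCongruent W' W 3 ∧
        ((∀ (κ : ZpExtension ℚ 3), κ.IsCyclotomic →
            ∃ (γ : Field.absoluteGaloisGroup ℚ) (D : W'.FineSelmerDualData κ γ),
              Module.Finite ℤ_[3] (RestrictScalars ℤ_[3] (IwasawaAlgebra 3) D.X)) ∨
          ∀ (κ : ZpExtension ℚ 3), κ.IsCyclotomic → Set.Finite {s : W'.selmerInfty κ | 3 • s = 0})) ∨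
    (∀ κL : ZpExtension (W.divisionField 3) 3, κL.IsCyclotomic → ClassicalMuVanishes κL)

/-- Statement of `stub_publishedInputs_LS18_CS05` (S3, cite-level, held by name): Lim–Sujatha 2018 Prop.
3.2 ((A) is an invariant of the mod-`p` Galois module) and Coates–Sujatha 2005 Thm. 3.4 (classical `μ = 0`
for `ℚ(E[p])_cyc` ⇒ (A) at `(E,p)`), as the registered named Literature facts. [LimSujatha2018 Prop 3.2
(p445851); CoatesSujatha2005 Thm 3.4 (p507734, typed from KuriharaPollack2007 §3.1 and RaySujatha2021 Thm 2.3)] -/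
abbrev Sig.stub_publishedInputs_LS18_CS05 : Prop :=
  LimSujatha2018.prop32_fineSelmerDual_moduleFinite_iff_of_torsionIso ∧
    CoatesSujatha2005.thm34_fineSelmerDual_moduleFinite_of_classicalMuVanishes_divisionField

/-- S1 — registered stub (Manin-dirty residue class; v1 verbatim). -/
theorem stub_residue_maninDirty : Sig.stub_residue_maninDirty := by
  sorry

/-- S2 — registered stub (multi-carrier residue class: mixed anchor certificate or classical `μ = 0`). -/
theorem stub_residue_multiCarrier_anchorOrClassicalMu :
    Sig.stub_residue_multiCarrier_anchorOrClassicalMu := by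
  sorry

/-- S3 — registered stub (cite-level: the two printed transfers, held by name). -/
theorem stub_publishedInputs_LS18_CS05 : Sig.stub_publishedInputs_LS18_CS05 := by
  sorry

/-- **The crux from the three stubs**: case split on the residue class of the optimal member, then on the
road taken on the multi-carrier class, concluding the K9 route decl BY NAME. -/
theorem WildCoatesSujathaResidue_of (h₁ : Sig.stub_residue_maninDirty)
    (h₂ : Sig.stub_residue_multiCarrier_anchorOrClassicalMu)
    (h₃ : Sig.stub_publishedInputs_LS18_CS05) :
    Summit.BirchSwinnertonDyer.BirchSwinnertonDyer.Theses.KatoDescentPotSupersingular.WildCoatesSujathaResidue := by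
  unfold Summit.BirchSwinnertonDyer.BirchSwinnertonDyer.Theses.KatoDescentPotSupersingular.WildCoatesSujathaResidue
  intro W _ _ _ hr hcl hirr hns hcm hopt κ hκ
  obtain ⟨W₀, hW₀e, hW₀m, hW₀n, D₀, hiso, hlat, hdisj⟩ := hopt
  rcases hdisj with hc | ⟨htam, hno⟩
  · exact h₁ W hr hcl hirr hns hcm ⟨W₀, hW₀e, hW₀m, hW₀n, D₀, hiso, hlat, hc⟩ κ hκ
  · obtain ⟨hLS, hCS⟩ := h₃
    rcases h₂ W hr hcl hirr hns hcm ⟨W₀, hW₀e, hW₀m, hW₀n, D₀, hiso, hlat, htam, hno⟩ with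
      ⟨W', hW'e, hcong, hA' | hfin⟩ | hmu
    · haveI := hW'e
      exact WildFineSelmerCongruenceFact.conjA_of_modPCongruent hLS (by decide) hcong hA' κ hκ
    · haveI := hW'e
      exact WildFineSelmerCongruenceFact.conjA_of_modPCongruent hLS (by decide) hcong
        (WildFineSelmerOrdinaryAnchor.conjA_rat_of_finite_selmerInfty_pTorsion W' hfin) κ hκ
    · exact hCS W 3 (by decide) hmu κ hκ

/-- **The aside implies the crux** (PROVED): (A) on every irreducible tower-non-surjective non-CM wild row
of class O6 (`WildFineSelmerCoatesSujatha`, item 19386, aside) gives (A) on the residue classes; so each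
class-form certificate theorem `wildFineSelmerCoatesSujatha_of_*Certificates` of the anchor files closes
this crux as well. -/
theorem residue_of_aside
    (h : Summit.BirchSwinnertonDyer.BirchSwinnertonDyer.Theses.KatoDescentPotSupersingular.WildFineSelmerCoatesSujatha) :
    Summit.BirchSwinnertonDyer.BirchSwinnertonDyer.Theses.KatoDescentPotSupersingular.WildCoatesSujathaResidue := by
  unfold Summit.BirchSwinnertonDyer.BirchSwinnertonDyer.Theses.KatoDescentPotSupersingular.WildCoatesSujathaResidue
  intro W _ _ _ hr hcl hirr hns hcm _ κ hκ
  exact h W hr hcl hirr hns hcm κ hκ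

/-- **Road (b1) made explicit** (PROVED, below Thm. 3.4 by name): on a multi-carrier residue row — indeed on
ANY elliptic `W/ℚ` — if every cyclotomic `ℤ₃`-tower of `ℚ(W[3])` has eventually constant `3`-class-number
exponent (Iwasawa's criterion gives `e_n = 0` throughout when `3 ∤ h(ℚ(W[3]))` and one prime lies over 3),
then (A) holds at `(W,3)`. [CoatesSujatha2005 Thm 3.4; Greenberg2001IwasawaPastPresent Prop 2.1] -/
theorem conjA_at_three_of_eventually_const_classNumberPExp
    (hCS : CoatesSujatha2005.thm34_fineSelmerDual_moduleFinite_of_classicalMuVanishes_divisionField)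
    (W : WeierstrassCurve ℚ) [W.IsElliptic] [Fact (3 : ℕ).Prime]
    (hc : ∀ κL : ZpExtension (W.divisionField 3) 3, κL.IsCyclotomic →
      ∃ c n₀ : ℕ, ∀ n, n₀ ≤ n → classNumberPExp κL n = c)
    (κ : ZpExtension ℚ 3) (hκ : κ.IsCyclotomic) :
    ∃ (γ : Field.absoluteGaloisGroup ℚ) (D : W.FineSelmerDualData κ γ),
      Module.Finite ℤ_[3] (RestrictScalars ℤ_[3] (IwasawaAlgebra 3) D.X) :=
  CoatesSujatha2005.fineSelmerDual_moduleFinite_of_eventually_const_classNumberPExp hCS W 3 (by decide)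
    hc κ hκ

end Summit.BirchSwinnertonDyer.BirchSwinnertonDyer.Cruxes.WildCoatesSujathaResidue.Birth

end
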